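import Summits.Schanuel.Schanuel.Theorems.RootDecomp1EScaleTransfer02

/-!
# RootDecomp1EScaleTransfer — lens 2, generation 35 «SCALE-TRANSFER CELL» (ScaleTransfer.lean bf37e395…, 1670 l) — continuation (RootDecomp1EScaleTransfer03): §4 THE CELLS — `InScaleClass`, `schanuel_on_scaleClass` (S itself on the scale class at every `n`, mod `hLW`), `eStableDefectOne_scaleCell` / `plainDefectOne_scaleCell` / `defectOneSchanuel_scaleCell`, `inScaleClass_of_algebraic`; §5a the `ℤ[√2]`-tower scale `ξ_Q` (`uQ`, `texp`, `fQ`, `xiQ`, `gamQ`, `pq`, `AQ`/`BQ`, `AB_bound`)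

(lens-2 g35 `ScaleTransfer.lean`, sha256 bf37e395…8f98, own farm rc 0 · 0 sorry · axioms std; critic VERDICT STATUS L1636 (d) PORT GO LOW;
port by census-1 gen 15 in five parts `RootDecomp1EScaleTransfer01`–`05` — see the PORT NOTE of part 01; `--supports stmt-Schanuel-31409`; rung 0.)
-/

noncomputable section

open Complex IntermediateField
open Summit.Schanuel.Schanuel.Theorems.RootDecomp1KHyper (LWMeasure SB SFset mvlen mvlen_nonneg
  abs_coeff_le_mvlen one_le_mvlen exists_int_mul_eq_map mvaeval_int_map sb_of_algebraicIndependent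
  mem_adjoin_SFset_I' form_ne_zero_of_linearIndependent)

namespace Summit.Schanuel.Schanuel.Theorems.RootDecomp1EScaleTransfer

variable {D n : ℕ}

/-! ## §4 The CELLS: `S` (hence `S⁻`, E-stable `S⁻`, plain `S⁻`) on the scale class, every length -/

/-- Scaling by `ξ` reflects ℚ-freeness. -/
theorem linearIndependent_of_scale {y : Fin n → ℂ} {ξ : ℂ}
    (hz : LinearIndependent ℚ (fun j => ξ * y j)) : LinearIndependent ℚ y := by
  rw [Fintype.linearIndependent_iff] at hz ⊢
  intro g hg
  apply hz g
  have : ∑ j, g j • (ξ * y j) = ξ * ∑ j, g j • y j := by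
    rw [Finset.mul_sum]
    exact Finset.sum_congr rfl fun j _ => (mul_smul_comm (g j) ξ (y j)).symm
  rw [this, hg, mul_zero]

/-- Scaling by `ξ ≠ 0` preserves ℚ-freeness. -/
theorem linearIndependent_scale {y : Fin n → ℂ} {ξ : ℂ} (hξ : ξ ≠ 0)
    (hy : LinearIndependent ℚ y) : LinearIndependent ℚ (fun j => ξ * y j) := by
  rw [Fintype.linearIndependent_iff] at hy ⊢
  intro g hg
  apply hy g
  have : ∑ j, g j • (ξ * y j) = ξ * ∑ j, g j • y j := by
    rw [Finset.mul_sum]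
    exact Finset.sum_congr rfl fun j _ => (mul_smul_comm (g j) ξ (y j)).symm
  rw [this] at hg
  exact (mul_eq_zero.mp hg).resolve_left hξ

/-- **`InScaleClass z`** — the cell predicate on tuples: `z = ξ · y` with the scale `ξ`
hyper-approximable through the order lattice of some algebraic ℚ-free `ω` (`HyperScaleApprox`). -/
def InScaleClass {n : ℕ} (z : Fin n → ℂ) : Prop :=
  ∃ (D : ℕ) (ω : Fin D → ℂ) (y : Fin n → ℂ) (ξ : ℂ), (∀ i, IsAlgebraic ℚ (ω i)) ∧
    LinearIndependent ℚ ω ∧ HyperScaleApprox ω y ξ ∧ z = fun j => ξ * y j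

/-- **CELL THEOREM — `S` ITSELF on the scale class, at EVERY length `n`** (mod `hLW`). -/
theorem schanuel_on_scaleClass (hLW : LWMeasure) (n : ℕ) (z : Fin n → ℂ)
    (hz : LinearIndependent ℚ z) (hcls : InScaleClass z) :
    (n : Cardinal) ≤ Algebra.trdeg ℚ
      ↥(IntermediateField.adjoin ℚ (Set.range z ∪ Set.range (cexp ∘ z))) := by
  obtain ⟨D, ω, y, ξ, hωalg, hω, hξ, rfl⟩ := hcls
  exact sb_scale hLW hωalg hω (linearIndependent_of_scale hz) hξ

/-- **CELL of item 25020 `DefectOneSchanuel` (S⁻)** — binders verbatim, the cell hypothesis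
`InScaleClass z` inserted after `LinearIndependent ℚ z`. -/
theorem defectOneSchanuel_scaleCell (hLW : LWMeasure) :
    ∀ (n : ℕ) (z : Fin n → ℂ), LinearIndependent ℚ z → InScaleClass z →
      (n : Cardinal) ≤ Algebra.trdeg ℚ
        ↥(IntermediateField.adjoin ℚ (Set.range z ∪ Set.range (Complex.exp ∘ z))) + 1 :=
  fun n z hz hcls => (schanuel_on_scaleClass hLW n z hz hcls).trans le_self_add

/-- **CELL of item 31409 `EStableDefectOne`** — binders verbatim (E-stability and the induction
hypothesis are carried, unused), the cell hypothesis `InScaleClass z` inserted after `LinearIndependent ℚ z`. -/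
theorem eStableDefectOne_scaleCell (hLW : LWMeasure) :
    ∀ (n : ℕ) (z : Fin n → ℂ), LinearIndependent ℚ z → InScaleClass z →
      (∃ β : ℂ, IsAlgebraic ℚ β ∧ β ∉ Set.range (algebraMap ℚ ℂ) ∧
        ∀ i, β * z i ∈ Submodule.span ℚ (Set.range z)) →
      (∀ (m : ℕ) (w : Fin m → ℂ), m < n → LinearIndependent ℚ w →
        (∀ j, w j ∈ Submodule.span ℚ (Set.range z)) →
        (m : Cardinal) ≤ Algebra.trdeg ℚ ↥(IntermediateField.adjoin ℚ
          (Set.range w ∪ Set.range (Complex.exp ∘ w))) + 1) →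
      (n : Cardinal) ≤ Algebra.trdeg ℚ ↥(IntermediateField.adjoin ℚ
        (Set.range z ∪ Set.range (Complex.exp ∘ z))) + 1 :=
  fun n z hz hcls _ _ => (schanuel_on_scaleClass hLW n z hz hcls).trans le_self_add

/-- **CELL of item 31410 `PlainDefectOne`** — binders verbatim (plainness carried, unused), the cell
hypothesis `InScaleClass z` inserted after `LinearIndependent ℚ z`. -/
theorem plainDefectOne_scaleCell (hLW : LWMeasure) :
    ∀ (n : ℕ) (z : Fin n → ℂ), LinearIndependent ℚ z → InScaleClass z →
      (∀ β : ℂ, IsAlgebraic ℚ β → (∀ i, β * z i ∈ Submodule.span ℚ (Set.range z)) →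
        β ∈ Set.range (algebraMap ℚ ℂ)) →
      (∀ (m : ℕ) (w : Fin m → ℂ), m < n → LinearIndependent ℚ w →
        (∀ j, w j ∈ Submodule.span ℚ (Set.range z)) →
        (m : Cardinal) ≤ Algebra.trdeg ℚ ↥(IntermediateField.adjoin ℚ
          (Set.range w ∪ Set.range (Complex.exp ∘ w))) + 1) →
      (n : Cardinal) ≤ Algebra.trdeg ℚ ↥(IntermediateField.adjoin ℚ
        (Set.range z ∪ Set.range (Complex.exp ∘ z))) + 1 :=
  fun n z hz hcls _ _ => (schanuel_on_scaleClass hLW n z hz hcls).trans le_self_add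

/-- **BOTTOM RUNG = LINDEMANN–WEIERSTRASS.** An algebraic ℚ-free tuple is in the scale class with
`ω = y = z`, `ξ = γ = 1`, `M = Id` (distance `0`). -/
theorem hyperScaleApprox_one (z : Fin n → ℂ) : HyperScaleApprox z z 1 := by
  intro m
  refine ⟨1, fun i j => if i = j then 1 else 0, one_ne_zero, fun j => ?_, ?_⟩
  · rw [one_mul]
    simp only [Int.cast_ite, Int.cast_one, Int.cast_zero, ite_mul, one_mul, zero_mul,
      Finset.sum_ite_eq', Finset.mem_univ, if_true]
  · rw [sub_self, norm_zero]; exact Real.exp_pos _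

/-- Bottom rung: a ℚ-free tuple of algebraic numbers is in the scale class (scale `ξ = 1`). -/
theorem inScaleClass_of_algebraic {z : Fin n → ℂ} (hzalg : ∀ i, IsAlgebraic ℚ (z i))
    (hz : LinearIndependent ℚ z) : InScaleClass z :=
  ⟨n, z, z, 1, hzalg, hz, hyperScaleApprox_one z, funext fun _ => (one_mul _).symm⟩

/-- Lindemann–Weierstrass (Schanuel's bound at algebraic ℚ-free tuples) as the bottom rung of the cell. -/
theorem sb_of_algebraic (hLW : LWMeasure) {z : Fin n → ℂ} (hzalg : ∀ i, IsAlgebraic ℚ (z i))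
    (hz : LinearIndependent ℚ z) : SB n z :=
  schanuel_on_scaleClass hLW n z hz (inScaleClass_of_algebraic hzalg hz)

/-! ## §5 An EXPLICIT CERTIFIED MEMBER: the `ℤ[√2]`-tower scale `ξ_Q`

`ξ_Q = Σ_k u^{t_k}`, `u = √2 − 1` (the fundamental unit of `ℤ[√2]`, `0 < u ≤ 1/2`), `t₀ = 1`,
`t_{k+1} = 3^(3^(k (t_k+5)) + 1)`.  The partial sums `γ_m = Σ_{k ≤ m} u^{t_k} = A_m + B_m √2 ∈ ℤ[√2]`,
`|A_m| + |B_m| ≤ 3^{t_m+1}`, approximate `ξ_Q` within `2u^{t_{m+1}} < exp(−exp((3^{t_m+5})^m))`, and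
`γ · (1, √2, i, i√2)` lies in the ℤ-span of `(1, √2, i, i√2)` for every `γ ∈ ℤ[√2]`. -/

/-- `u = √2 − 1`. -/
def uQ : ℝ := Real.sqrt 2 - 1

/-- `√2 < 3/2`. -/
private theorem sqrt_two_lt_three_halves : Real.sqrt 2 < 3 / 2 := by
  rw [show (3 / 2 : ℝ) = Real.sqrt ((3 / 2) ^ 2) by rw [Real.sqrt_sq (by norm_num)]]
  exact Real.sqrt_lt_sqrt (by norm_num) (by norm_num)

/-- `1 < √2`. -/
private theorem one_lt_sqrt_two' : 1 < Real.sqrt 2 := by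
  rw [show (1 : ℝ) = Real.sqrt 1 by simp]
  exact Real.sqrt_lt_sqrt (by norm_num) (by norm_num)

/-- `u_Q = √2 − 1 > 0`. -/
theorem uQ_pos : 0 < uQ := by unfold uQ; linarith [one_lt_sqrt_two']
/-- `u_Q = √2 − 1 ≤ 1/2`. -/
theorem uQ_le_half : uQ ≤ 1 / 2 := by unfold uQ; linarith [sqrt_two_lt_three_halves]
/-- `u_Q < 1`. -/
theorem uQ_lt_one : uQ < 1 := by linarith [uQ_le_half]

/-- The tower of exponents. -/
def texp : ℕ → ℕ
  | 0 => 1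
  | k + 1 => 3 ^ (3 ^ (k * (texp k + 5)) + 1)

/-- `texp 0 = 1`. -/
theorem texp_zero : texp 0 = 1 := rfl
/-- `texp (k+1) = 3^(3^(k·(texp k + 5)) + 1)`. -/
theorem texp_succ (k : ℕ) : texp (k + 1) = 3 ^ (3 ^ (k * (texp k + 5)) + 1) := rfl

/-- `texp k + 1 ≤ texp (k+1)`. -/
theorem texp_succ_ge (k : ℕ) : texp k + 1 ≤ texp (k + 1) := by
  rw [texp_succ]
  have h1 : k * (texp k + 5) < 3 ^ (k * (texp k + 5)) := Nat.lt_pow_self (by norm_num)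
  have h2 : 3 ^ (k * (texp k + 5)) + 1 < 3 ^ (3 ^ (k * (texp k + 5)) + 1) :=
    Nat.lt_pow_self (by norm_num)
  rcases Nat.eq_zero_or_pos k with rfl | hk
  · rw [texp_zero] at *; omega
  · have : texp k + 5 ≤ k * (texp k + 5) := Nat.le_mul_of_pos_left _ hk
    omega

/-- The tower exponents `texp` are strictly increasing. -/
theorem texp_strictMono : StrictMono texp :=
  strictMono_nat_of_lt_succ fun k => Nat.lt_of_lt_of_le (Nat.lt_succ_self _) (texp_succ_ge k)

/-- `k ≤ texp k`. -/
theorem le_texp (k : ℕ) : k ≤ texp k := texp_strictMono.id_le k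

/-- `1 ≤ texp k`. -/
theorem one_le_texp (k : ℕ) : 1 ≤ texp k := by
  rcases k with _ | k
  · rw [texp_zero]
  · exact (Nat.succ_le_succ (Nat.zero_le _)).trans ((le_texp (k + 1)))

/-- `texp k + j ≤ texp (k + j)`. -/
theorem texp_add_le (k j : ℕ) : texp k + j ≤ texp (k + j) := by
  induction j with
  | zero => simp
  | succ j ih =>
    calc texp k + (j + 1) = (texp k + j) + 1 := by ring
      _ ≤ texp (k + j) + 1 := by omega
      _ ≤ texp (k + j + 1) := texp_succ_ge _
      _ = texp (k + (j + 1)) := by rw [add_assoc]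

/-- The terms `u^{t_k}`. -/
def fQ (k : ℕ) : ℝ := uQ ^ texp k

/-- The terms `u_Q^{texp k}` are positive. -/
theorem fQ_pos (k : ℕ) : 0 < fQ k := pow_pos uQ_pos _
/-- `u_Q^{texp k} ≤ u_Q^k`. -/
theorem fQ_le_geom (k : ℕ) : fQ k ≤ uQ ^ k :=
  pow_le_pow_of_le_one uQ_pos.le uQ_lt_one.le (le_texp k)

/-- The series `Σ_k u_Q^{texp k}` is summable. -/
theorem summable_fQ : Summable fQ :=
  Summable.of_nonneg_of_le (fun k => (fQ_pos k).le) fQ_le_geom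
    (summable_geometric_of_lt_one uQ_pos.le uQ_lt_one)

/-- **The scale `ξ_Q = Σ_k u^{t_k}`.** -/
def xiQ : ℝ := ∑' k, fQ k

/-- The approximants `γ_m = Σ_{k ≤ m} u^{t_k}`. -/
def gamQ (m : ℕ) : ℝ := ∑ k ∈ Finset.range (m + 1), fQ k

/-- The partial sums `γ_m` are positive. -/
theorem gamQ_pos (m : ℕ) : 0 < gamQ m :=
  Finset.sum_pos (fun k _ => fQ_pos k) ⟨0, by simp⟩

/-- `ξ_Q > 0`. -/
theorem xiQ_pos : 0 < xiQ := summable_fQ.tsum_pos (fun k => (fQ_pos k).le) 0 (fQ_pos 0)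

/-- `ξ_Q − γ_m` is the tail `Σ_k u_Q^{texp (k+m+1)}`. -/
theorem xiQ_sub_gamQ (m : ℕ) : xiQ - gamQ m = ∑' k, fQ (k + (m + 1)) := by
  rw [xiQ, gamQ, ← summable_fQ.sum_add_tsum_nat_add (m + 1)]; ring

/-- Tail terms: `u_Q^{texp (k+m+1)} ≤ u_Q^{texp (m+1)} · u_Q^k`. -/
theorem fQ_shift_le (m k : ℕ) : fQ (k + (m + 1)) ≤ uQ ^ texp (m + 1) * uQ ^ k := by
  rw [fQ, ← pow_add]
  apply pow_le_pow_of_le_one uQ_pos.le uQ_lt_one.le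
  rw [add_comm k]
  exact texp_add_le (m + 1) k

/-- `0 ≤ ξ_Q − γ_m`. -/
theorem xiQ_sub_gamQ_nonneg (m : ℕ) : 0 ≤ xiQ - gamQ m := by
  rw [xiQ_sub_gamQ]
  exact tsum_nonneg fun k => (fQ_pos _).le

/-- **Tail bound:** `ξ_Q − γ_m ≤ 2 u^{t_{m+1}}`. -/
theorem xiQ_sub_gamQ_le (m : ℕ) : xiQ - gamQ m ≤ 2 * uQ ^ texp (m + 1) := by
  rw [xiQ_sub_gamQ]
  have hgeom := summable_geometric_of_lt_one uQ_pos.le uQ_lt_one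
  have hs : Summable fun k => uQ ^ texp (m + 1) * uQ ^ k := hgeom.mul_left _
  have hshift : Summable fun k => fQ (k + (m + 1)) := (summable_nat_add_iff (m + 1)).2 summable_fQ
  calc ∑' k, fQ (k + (m + 1)) ≤ ∑' k, uQ ^ texp (m + 1) * uQ ^ k :=
        hshift.tsum_le_tsum (fQ_shift_le m) hs
    _ = uQ ^ texp (m + 1) * (1 - uQ)⁻¹ := by
        rw [hgeom.tsum_mul_left, tsum_geometric_of_lt_one uQ_pos.le uQ_lt_one]
    _ ≤ uQ ^ texp (m + 1) * 2 := by
        apply mul_le_mul_of_nonneg_left _ (pow_nonneg uQ_pos.le _)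
        rw [inv_le_comm₀ (by linarith [uQ_lt_one]) (by norm_num)]
        linarith [uQ_le_half]
    _ = 2 * uQ ^ texp (m + 1) := mul_comm _ _

/-- `ℤ[√2]`-coordinates of `u^t`: `u^t = p_t + q_t √2`. -/
def pq : ℕ → ℤ × ℤ
  | 0 => (1, 0)
  | t + 1 => (2 * (pq t).2 - (pq t).1, (pq t).1 - (pq t).2)

/-- `√2 · √2 = 2`. -/
private theorem sqrt_two_mul_self : Real.sqrt 2 * Real.sqrt 2 = 2 :=
  Real.mul_self_sqrt (by norm_num)

/-- `u_Q^t = p_t + q_t √2` with `(p_t, q_t) = pq t ∈ ℤ × ℤ`. -/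
theorem uQ_pow_eq (t : ℕ) : uQ ^ t = ((pq t).1 : ℝ) + ((pq t).2 : ℝ) * Real.sqrt 2 := by
  induction t with
  | zero => simp [pq]
  | succ t ih =>
    rw [pow_succ, ih, pq]
    push_cast
    unfold uQ
    linear_combination ((pq t).2 : ℝ) * sqrt_two_mul_self

/-- `|p_t| + |q_t| ≤ 3^t`. -/
theorem pq_bound (t : ℕ) : |(pq t).1| + |(pq t).2| ≤ 3 ^ t := by
  induction t with
  | zero => simp [pq]
  | succ t ih =>
    rw [pq, pow_succ]
    have h1 : |2 * (pq t).2 - (pq t).1| ≤ 2 * |(pq t).2| + |(pq t).1| := by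
      calc |2 * (pq t).2 - (pq t).1| ≤ |2 * (pq t).2| + |(pq t).1| := abs_sub _ _
        _ = 2 * |(pq t).2| + |(pq t).1| := by rw [abs_mul, abs_two]
    have h2 : |(pq t).1 - (pq t).2| ≤ |(pq t).1| + |(pq t).2| := abs_sub _ _
    linarith [abs_nonneg (pq t).1, abs_nonneg (pq t).2]

/-- Integer coordinates of `γ_m = A_m + B_m √2`. -/
def AQ (m : ℕ) : ℤ := ∑ k ∈ Finset.range (m + 1), (pq (texp k)).1
/-- `B_m = Σ_{k ≤ m} q_{texp k}`, the `√2`-part of `γ_m`. -/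
def BQ (m : ℕ) : ℤ := ∑ k ∈ Finset.range (m + 1), (pq (texp k)).2

/-- `γ_m = A_m + B_m √2` with `A_m, B_m ∈ ℤ`. -/
theorem gamQ_eq (m : ℕ) : gamQ m = (AQ m : ℝ) + (BQ m : ℝ) * Real.sqrt 2 := by
  rw [gamQ, AQ, BQ]
  push_cast
  rw [Finset.sum_mul, ← Finset.sum_add_distrib]
  exact Finset.sum_congr rfl fun k _ => uQ_pow_eq _

/-- `Σ_{k ≤ m} 3^{texp k} ≤ 3^{texp m + 1}`. -/
theorem sum_pow_texp_le (m : ℕ) : ∑ k ∈ Finset.range (m + 1), (3 : ℤ) ^ texp k ≤ 3 ^ (texp m + 1) := by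
  induction m with
  | zero => simp [texp_zero]
  | succ m ih =>
    rw [Finset.sum_range_succ]
    have h1 : (3 : ℤ) ^ (texp m + 1) ≤ 3 ^ texp (m + 1) :=
      pow_le_pow_right₀ (by norm_num) (texp_succ_ge m)
    have h0 : (0 : ℤ) ≤ 3 ^ texp (m + 1) := by positivity
    calc _ ≤ (3 : ℤ) ^ (texp m + 1) + 3 ^ texp (m + 1) := by linarith
      _ ≤ 3 ^ texp (m + 1) + 3 ^ texp (m + 1) := by linarith
      _ ≤ 3 ^ (texp (m + 1) + 1) := by rw [pow_succ]; linarith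

/-- `|A_m| + |B_m| ≤ 3^{texp m + 1}`. -/
theorem AB_bound (m : ℕ) : |AQ m| + |BQ m| ≤ 3 ^ (texp m + 1) := by
  rw [AQ, BQ]
  calc |∑ k ∈ Finset.range (m + 1), (pq (texp k)).1| + |∑ k ∈ Finset.range (m + 1), (pq (texp k)).2|
      ≤ ∑ k ∈ Finset.range (m + 1), |(pq (texp k)).1| + ∑ k ∈ Finset.range (m + 1), |(pq (texp k)).2| :=
        add_le_add (Finset.abs_sum_le_sum_abs _ _) (Finset.abs_sum_le_sum_abs _ _)
    _ = ∑ k ∈ Finset.range (m + 1), (|(pq (texp k)).1| + |(pq (texp k)).2|) :=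
        (Finset.sum_add_distrib).symm
    _ ≤ ∑ k ∈ Finset.range (m + 1), (3 : ℤ) ^ texp k := Finset.sum_le_sum fun k _ => pq_bound _
    _ ≤ 3 ^ (texp m + 1) := sum_pow_texp_le m

/-- **The hyper-approximation inequality of the tower:** `2 u^{t_{m+1}} < exp(−exp((3^{t_m+5})^m))`. -/
theorem approxQ (m : ℕ) :
    2 * uQ ^ texp (m + 1) < Real.exp (-Real.exp (((3 : ℝ) ^ (texp m + 5)) ^ m)) := by
  -- E = exp(3^{m(t+5)}) ≤ 3^{3^{m(t+5)}} = P and t' = 3 P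
  set N₁ : ℕ := 3 ^ (m * (texp m + 5)) with hN₁
  set P : ℕ := 3 ^ N₁ with hP
  have hx : ((3 : ℝ) ^ (texp m + 5)) ^ m = (N₁ : ℝ) := by
    rw [hN₁, ← pow_mul, mul_comm]; push_cast; ring
  rw [hx]
  have hN₁1 : (1 : ℝ) ≤ N₁ := by exact_mod_cast Nat.one_le_pow _ _ (by norm_num)
  have he3 : Real.exp 1 ≤ 3 := by linarith [Real.exp_one_lt_d9]
  have hE_le : Real.exp (N₁ : ℝ) ≤ (P : ℝ) := by
    rw [hP]; push_cast
    calc Real.exp (N₁ : ℝ) = Real.exp 1 ^ N₁ := by rw [← Real.exp_nat_mul, mul_one]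
      _ ≤ 3 ^ N₁ := pow_le_pow_left₀ (Real.exp_pos 1).le he3 N₁
  have ht' : (texp (m + 1) : ℝ) = 3 * P := by
    rw [texp_succ, ← hN₁, pow_succ, hP]; push_cast; ring
  have hE1 : Real.exp 1 ≤ Real.exp (N₁ : ℝ) := Real.exp_le_exp.mpr hN₁1
  have he2 : (2 : ℝ) < Real.exp 1 := by linarith [Real.exp_one_gt_d9]
  -- u^{t'} ≤ exp(-1/2)^{t'} = exp(-t'/2)
  have hhalf : (1 : ℝ) / 2 ≤ Real.exp (-(1 / 2)) := by
    have h2 : Real.exp (1 / 2) ≤ 2 := by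
      have hsq : Real.exp (1 / 2) ^ 2 = Real.exp 1 := by
        rw [← Real.exp_nat_mul]; norm_num
      nlinarith [Real.exp_pos (1 / 2 : ℝ), Real.exp_one_lt_d9]
    rw [Real.exp_neg, le_inv_comm₀ (by norm_num) (Real.exp_pos _)]
    have h3 : ((1 : ℝ) / 2)⁻¹ = 2 := by norm_num
    rw [h3]; exact h2
  have hu : uQ ^ texp (m + 1) ≤ Real.exp (-((texp (m + 1) : ℝ) / 2)) := by
    calc uQ ^ texp (m + 1) ≤ (1 / 2 : ℝ) ^ texp (m + 1) :=
          pow_le_pow_left₀ uQ_pos.le uQ_le_half _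
      _ ≤ Real.exp (-(1 / 2)) ^ texp (m + 1) := pow_le_pow_left₀ (by norm_num) hhalf _
      _ = Real.exp (-((texp (m + 1) : ℝ) / 2)) := by
          rw [← Real.exp_nat_mul]; congr 1; ring
  -- the gap: t'/2 - E ≥ E/2 > 1
  have hgap : 1 < (texp (m + 1) : ℝ) / 2 - Real.exp (N₁ : ℝ) := by
    rw [ht']
    have : Real.exp (N₁ : ℝ) / 2 > 1 := by linarith
    linarith
  have hkey : 2 * Real.exp (-((texp (m + 1) : ℝ) / 2)) < Real.exp (-Real.exp (N₁ : ℝ)) := by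
    have h1 : Real.exp (-Real.exp (N₁ : ℝ)) =
        Real.exp (-((texp (m + 1) : ℝ) / 2)) * Real.exp ((texp (m + 1) : ℝ) / 2 - Real.exp (N₁ : ℝ)) := by
      rw [← Real.exp_add]; congr 1; ring
    rw [h1, mul_comm]
    apply mul_lt_mul_of_pos_left _ (Real.exp_pos _)
    calc (2 : ℝ) < Real.exp 1 := he2
      _ ≤ Real.exp ((texp (m + 1) : ℝ) / 2 - Real.exp (N₁ : ℝ)) := Real.exp_le_exp.mpr hgap.le
  calc 2 * uQ ^ texp (m + 1) ≤ 2 * Real.exp (-((texp (m + 1) : ℝ) / 2)) := by linarith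
    _ < Real.exp (-Real.exp (N₁ : ℝ)) := hkey

/-- **`|ξ_Q − γ_m| < exp(−exp(s^m))` for every `s ≤ 3^{t_m+5}`, `0 ≤ s`.** -/
theorem xiQ_approx (m : ℕ) {s : ℝ} (hs0 : 0 ≤ s) (hs : s ≤ (3 : ℝ) ^ (texp m + 5)) :
    |xiQ - gamQ m| < Real.exp (-Real.exp (s ^ m)) := by
  rw [abs_of_nonneg (xiQ_sub_gamQ_nonneg m)]
  calc xiQ - gamQ m ≤ 2 * uQ ^ texp (m + 1) := xiQ_sub_gamQ_le m
    _ < Real.exp (-Real.exp (((3 : ℝ) ^ (texp m + 5)) ^ m)) := approxQ m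
    _ ≤ Real.exp (-Real.exp (s ^ m)) := by
        apply Real.exp_le_exp.mpr; apply neg_le_neg; apply Real.exp_le_exp.mpr
        exact pow_le_pow_left₀ hs0 hs m

end Summit.Schanuel.Schanuel.Theorems.RootDecomp1EScaleTransfer

end
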